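import Summits.Schanuel.Schanuel.Theorems.RootDecomp1BFinitePinningFloor06
import Mathlib.NumberTheory.SumTwoSquares
import Mathlib.NumberTheory.PrimesCongruentOne
import Mathlib.RingTheory.Localization.Module

/-!
# `RootDecomp1BFinitePinningFloor` — part 07 of 08 (`RootDecomp1BFinitePinningFloor07`): §11 THE FINITE PINNING FLOOR AT LENGTH ONE, number theory — unique factorisation in `ℤ[i]` by the reduction `ℤ[i] → 𝔽_q`, `i ↦ -a/b` (`gaussian_mul_star`, `gaussian_exists_hom_killing`, `gaussian_no_identity`, `gaussian_identity_trivial`, `gaussian_identity_of_complex`, `exp_arg_mul_I_of_norm_one`, `gaussian_linearIndependent_int_arg`) and the family `β_j = (a_j + i b_j)²/q_j` over the primes `q_j ≡ 1 (mod 4)` (`goodPrime`, `goodPrime_infinite`, `qG`, `aG`, `bG` (Fermat, `Nat.Prime.sq_add_sq`), `wG`, `βG`, `norm_βG`, `βG_isAlgebraic`, `tG = arg βG`, `exp_tG_mul_I`)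

Part 7 of the port of the lens-4 gen-23 kernel `FinitePinningFloor.lean`. Parts 07–08 (§11, appended 2026-08-30 to the six-part port 01–06; ≤ 400 lines each, shared namespace `Summit.Schanuel.Schanuel.Theorems.RootDecomp1BFinitePinningFloor`, each part importing the previous; `--supports stmt-Schanuel-24622`) of the decomp-schanuel lens-4 kernel file `HOME/decomp-schanuel-lens-4/g23/FinitePinningFloor.lean` (gen 23, §1–§11, sha256 92a2b0f8f9b538e5…; `lean check` rc 0 · 0 sorry · standard axioms; see part 01 for the overview of §1–§10, the construction of pinned shears and the reading for the crux). 

What §11 adds to the port (from the kernel overview):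

* §11 THE FINITE PINNING FLOOR AT LENGTH ONE (§6 ∧ §10 uniformly in `F`): `gaussian_exists_hom_killing`
  (`ℤ[i] → 𝔽_q`, `i ↦ -a/b`, kills `a+bi`, not `a-bi`), `gaussian_no_identity` / `gaussian_identity_trivial`
  (no `∏ w_j^{2n⁺_j} q_j^{n⁻_j} = ∏ w_j^{2n⁻_j} q_j^{n⁺_j}` over distinct primes `q_j = w_j w̄_j ≡ 1 (4)` unless
  `n = 0`), `gaussian_linearIndependent_int_arg`; the family `qG, aG, bG, wG, βG = wG²/qG, tG = arg βG` over the
  primes `≡ 1 (4)` (`goodPrime_infinite`), `norm_βG`, `βG_isAlgebraic`, `linearIndependent_tG_int / _rat`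
  (**the unit circle has infinite algebraic rank**: `exists_unimodular_algebraic_independent_args`),
  `linearIndependent_tG_A` (BAKER), `exists_tG_not_mem`; `exists_pow_not_mem` (powers of a transcendental real
  escape every finite-dimensional `F`); `exp_tG_transcendental` (GELFOND–SCHNEIDER); `exists_fixedPoint_shear (F)`
  (a shear killing `F, 1, π` with `u = e^{k t_j} ∉ F`, `ℓ = k t_j`: `E u = u` transcendental, `E(iu) = β_j^k`
  algebraic); **`hyperplanePinningFloorOne (F)`, `finitePinningFloorOne (F)`, `finitePinningFloorOne_periodPackage
  (hN) (F)`, `finiteTablePinningFloorOne (hN) (T)`** — for EVERY finite-dimensional `F` (every finite `T ⊂ ℂ`) an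
  `E` with (E1)–(E4), (P1)–(P3), `E = exp` on an `A`-hyperplane `H ⊕ iH ⊇ F ⊕ iF` (on `T`), non-measurable,
  failing `X(1)` at a transcendental fixed point, `X`, `LSB(1)`, `T0(0)`, `S(2)`, `S`; headlines
  `kleinPolarCellOne_/localSurplusBudget_/tameDefectZeroStep_false_without_channel_beyond_finite_pinning (hN) (F)`
  (+ hypothesis-free primed forms) and `finitePinningFloorOne_exp_dictionary`.
-/

noncomputable section

open Complex


namespace Summit.Schanuel.Schanuel.Theorems.RootDecomp1BFinitePinningFloor

open Summit.Schanuel.Schanuel.Theorems.RootDecomp1BTranscendencePackageFloor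
open Summit.Schanuel.Schanuel.Theorems.RootDecomp1BPeriodKernelFloor
open Literature.NumberTheory.Transcendental (nesterenko baker_holds SchanuelRank transcendental_pi_holds)

/-! ## §11 THE FINITE PINNING FLOOR AT LENGTH ONE — finite pinning buys nothing even at the first
storey: for EVERY finite-dimensional `A`-subspace `F ⊂ ℝ`, ONE exponential agreeing with `exp` on an
`A`-hyperplane `H ⊕ iH ⊇ F ⊕ iF`, with (E1)–(E4), (P1)–(P3), fails `X(1)`, `LSB(1)`, `T0(0)`,
`S(2)`, `S` (uniform form of §6 ∧ §10)

The `(3+4i)/5` model of §9–§10 moves a point of the plane `A s₀ ⊕ A γ₀^{1,2}`; a table of values of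
`exp` containing `s₀` pins it. To beat EVERY finite table one needs an INFINITE `A`-free family of
ARGUMENTS OF UNIMODULAR ALGEBRAIC NUMBERS: `t_q = arg((a_q + i b_q)²/q)` over the primes
`q = a_q² + b_q² ≡ 1 (mod 4)`. Their `ℚ`-freeness is unique factorisation in `ℤ[i]`, done here by an
elementary reduction `ℤ[i] → 𝔽_q`, `i ↦ -a_q/b_q` (which kills `a_q + i b_q` but neither its conjugate
nor any other `a_{q'} ± i b_{q'}`); Baker upgrades `ℚ`-free to `A`-free; Gelfond–Schneider makes
`γ_q = e^{t_q} = β_q^{-i}` transcendental, so some power `γ_q^k ∉ F`; the pinned shear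
`γ_q^k ↦ k t_q` then has the transcendental fixed point `E(γ_q^k) = γ_q^k` with `E(iγ_q^k) = β_q^k`
algebraic, and §7/§10 apply verbatim. -/

section GaussianPrimes

/-- In `ℤ[i]`: `w · w̄ = (re w)² + (im w)²`. [folklore] -/
theorem gaussian_mul_star (w : GaussianInt) :
    w * star w = ((w.re ^ 2 + w.im ^ 2 : ℤ) : GaussianInt) := by
  ext
  · simp [Zsqrtd.re_mul, Zsqrtd.re_star, Zsqrtd.im_star, sq]
  · simp [Zsqrtd.im_mul, Zsqrtd.re_star, Zsqrtd.im_star, sq]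
    ring

/-- THE REDUCTION `ℤ[i] → 𝔽_q`, `i ↦ -a/b`: it KILLS `w = a + bi` but not `w̄ = a - bi`
(`a² + b² = q` prime, `q ∤ a, b`, `q ≠ 2`). [folklore] -/
theorem gaussian_exists_hom_killing {q : ℕ} [Fact q.Prime] (w : GaussianInt)
    (hw : w.re ^ 2 + w.im ^ 2 = q) (ha : ((w.re : ℤ) : ZMod q) ≠ 0) (hb : ((w.im : ℤ) : ZMod q) ≠ 0)
    (h2 : (2 : ZMod q) ≠ 0) : ∃ φ : GaussianInt →+* ZMod q, φ w = 0 ∧ φ (star w) ≠ 0 := by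
  have hab : ((w.re : ℤ) : ZMod q) ^ 2 + ((w.im : ℤ) : ZMod q) ^ 2 = 0 := by
    have h := congrArg (Int.cast : ℤ → ZMod q) hw
    push_cast at h
    rw [h, ZMod.natCast_self]
  set a : ZMod q := ((w.re : ℤ) : ZMod q) with ha_def
  set b : ZMod q := ((w.im : ℤ) : ZMod q) with hb_def
  have ha2 : a ^ 2 = -b ^ 2 := eq_neg_of_add_eq_zero_left hab
  have hc : (-a * b⁻¹) * (-a * b⁻¹) = ((-1 : ℤ) : ZMod q) := by
    push_cast
    rw [show -a * b⁻¹ * (-a * b⁻¹) = a ^ 2 * (b⁻¹) ^ 2 by ring, ha2]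
    field_simp
  refine ⟨Zsqrtd.lift ⟨-a * b⁻¹, hc⟩, ?_, ?_⟩
  · rw [Zsqrtd.lift_apply_apply]
    show a + b * (-a * b⁻¹) = 0
    field_simp
    ring
  · rw [Zsqrtd.lift_apply_apply, Zsqrtd.re_star, Zsqrtd.im_star]
    push_cast
    show a + -b * (-a * b⁻¹) ≠ 0
    rw [show a + -b * (-a * b⁻¹) = 2 * a by field_simp; ring]
    exact mul_ne_zero h2 ha

/-- UNIQUE FACTORISATION, elementary form (one sign): there is no identity
`∏ w_j^{2n⁺_j} ∏ q_j^{n⁻_j} = ∏ w_j^{2n⁻_j} ∏ q_j^{n⁺_j}` in `ℤ[i]` with `n⁺_{j₀} > 0 = n⁻_{j₀}`, for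
distinct odd primes `q_j = a_j² + b_j²` and `w_j = a_j + i b_j` (reduce modulo the prime `w_{j₀}`
after cancelling `w_{j₀}^{n}`). [folklore] -/
theorem gaussian_no_identity {N : ℕ} {q : Fin N → ℕ} (hq : ∀ j, (q j).Prime)
    (hqinj : Function.Injective q) (hodd : ∀ j, q j ≠ 2) {w : Fin N → GaussianInt}
    (hw : ∀ j, (w j).re ^ 2 + (w j).im ^ 2 = q j) (ha : ∀ j, (((w j).re : ℤ) : ZMod (q j)) ≠ 0)
    (hb : ∀ j, (((w j).im : ℤ) : ZMod (q j)) ≠ 0) {np nm : Fin N → ℕ} {j₀ : Fin N}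
    (hpos : 0 < np j₀) (hzero : nm j₀ = 0)
    (h : (∏ j, w j ^ (2 * np j)) * ∏ j, (q j : GaussianInt) ^ nm j =
      (∏ j, w j ^ (2 * nm j)) * ∏ j, (q j : GaussianInt) ^ np j) : False := by
  classical
  haveI : Fact (q j₀).Prime := ⟨hq j₀⟩
  have h2 : (2 : ZMod (q j₀)) ≠ 0 := by
    intro h2
    have hd := (ZMod.natCast_eq_zero_iff 2 (q j₀)).mp (by exact_mod_cast h2)
    exact hodd j₀ ((Nat.prime_dvd_prime_iff_eq (hq j₀) Nat.prime_two).mp hd)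
  obtain ⟨φ, hφw, hφs⟩ := gaussian_exists_hom_killing (w j₀) (hw j₀) (ha j₀) (hb j₀) h2
  have hφq : ∀ j, j ≠ j₀ → φ (q j : GaussianInt) ≠ 0 := by
    intro j hj h0
    rw [map_natCast] at h0
    have hd := (ZMod.natCast_eq_zero_iff (q j) (q j₀)).mp h0
    exact hj (hqinj ((Nat.prime_dvd_prime_iff_eq (hq j₀) (hq j)).mp hd)).symm
  have hws : ∀ j, w j * star (w j) = (q j : GaussianInt) := by
    intro j
    rw [gaussian_mul_star, hw j]
    norm_cast
  have hφw' : ∀ j, j ≠ j₀ → φ (w j) ≠ 0 := by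
    intro j hj h0
    apply hφq j hj
    rw [← hws j, map_mul, h0, zero_mul]
  have hw0 : w j₀ ≠ 0 := by
    intro h0
    have h1 := hw j₀
    rw [h0] at h1
    simp at h1
    exact (hq j₀).ne_zero (by exact_mod_cast h1.symm)
  set L := (∏ j ∈ Finset.univ.erase j₀, w j ^ (2 * np j)) * ∏ j, (q j : GaussianInt) ^ nm j with hL
  set R := (∏ j, w j ^ (2 * nm j)) * ∏ j ∈ Finset.univ.erase j₀, (q j : GaussianInt) ^ np j with hR
  clear_value L R
  have eL : (∏ j, w j ^ (2 * np j)) * ∏ j, (q j : GaussianInt) ^ nm j =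
      w j₀ ^ np j₀ * (w j₀ ^ np j₀ * L) := by
    rw [← Finset.mul_prod_erase Finset.univ (fun j => w j ^ (2 * np j)) (Finset.mem_univ j₀), hL]
    ring
  have eR : (∏ j, w j ^ (2 * nm j)) * ∏ j, (q j : GaussianInt) ^ np j =
      w j₀ ^ np j₀ * (star (w j₀) ^ np j₀ * R) := by
    rw [← Finset.mul_prod_erase Finset.univ (fun j => (q j : GaussianInt) ^ np j) (Finset.mem_univ j₀),
      hR]
    simp only [← hws j₀, mul_pow]
    ring
  rw [eL, eR] at h
  have h' := mul_left_cancel₀ (pow_ne_zero (np j₀) hw0) h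
  have hφ := congrArg φ h'
  rw [map_mul, map_mul, map_pow, map_pow, hφw, zero_pow hpos.ne', zero_mul] at hφ
  have hR0 : φ R ≠ 0 := by
    rw [hR, map_mul, map_prod, map_prod]
    refine mul_ne_zero (Finset.prod_ne_zero_iff.mpr fun j _ => ?_)
      (Finset.prod_ne_zero_iff.mpr fun j hj => ?_)
    · rw [map_pow]
      by_cases hj : j = j₀
      · subst hj
        rw [hzero, mul_zero, pow_zero]
        exact one_ne_zero
      · exact pow_ne_zero _ (hφw' j hj)
    · rw [map_pow]
      exact pow_ne_zero _ (hφq j (Finset.ne_of_mem_erase hj))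
  exact mul_ne_zero (pow_ne_zero (np j₀) hφs) hR0 hφ.symm

/-- UNIQUE FACTORISATION, elementary form (both signs): such an identity with
`n⁺_j · n⁻_j = 0` forces `n⁺ = n⁻ = 0`. [folklore] -/
theorem gaussian_identity_trivial {N : ℕ} {q : Fin N → ℕ} (hq : ∀ j, (q j).Prime)
    (hqinj : Function.Injective q) (hodd : ∀ j, q j ≠ 2) {w : Fin N → GaussianInt}
    (hw : ∀ j, (w j).re ^ 2 + (w j).im ^ 2 = q j) (ha : ∀ j, (((w j).re : ℤ) : ZMod (q j)) ≠ 0)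
    (hb : ∀ j, (((w j).im : ℤ) : ZMod (q j)) ≠ 0) {np nm : Fin N → ℕ}
    (hdisj : ∀ j, np j = 0 ∨ nm j = 0)
    (h : (∏ j, w j ^ (2 * np j)) * ∏ j, (q j : GaussianInt) ^ nm j =
      (∏ j, w j ^ (2 * nm j)) * ∏ j, (q j : GaussianInt) ^ np j) (j : Fin N) :
    np j = 0 ∧ nm j = 0 := by
  rcases hdisj j with h0 | h0
  · refine ⟨h0, ?_⟩
    by_contra h1
    exact gaussian_no_identity hq hqinj hodd hw ha hb (Nat.pos_of_ne_zero h1) h0 h.symm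
  · refine ⟨?_, h0⟩
    by_contra h1
    exact gaussian_no_identity hq hqinj hodd hw ha hb (Nat.pos_of_ne_zero h1) h0 h

/-- From the complex identity `∏ β_j^{n⁺_j} = ∏ β_j^{n⁻_j}`, `β_j = w_j²/q_j`, to the `ℤ[i]` identity
(`ℤ[i] ↪ ℂ`). [folklore] -/
theorem gaussian_identity_of_complex {N : ℕ} {q : Fin N → ℕ} (hq0 : ∀ j, q j ≠ 0)
    (w : Fin N → GaussianInt) {np nm : Fin N → ℕ}
    (h : ∏ j, (GaussianInt.toComplex (w j) ^ 2 / (q j : ℂ)) ^ np j =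
      ∏ j, (GaussianInt.toComplex (w j) ^ 2 / (q j : ℂ)) ^ nm j) :
    (∏ j, w j ^ (2 * np j)) * ∏ j, (q j : GaussianInt) ^ nm j =
      (∏ j, w j ^ (2 * nm j)) * ∏ j, (q j : GaussianInt) ^ np j := by
  apply GaussianInt.toComplex_inj.mp
  simp only [map_mul, map_prod, map_pow, map_natCast]
  have key : ∀ (j) (m : ℕ), GaussianInt.toComplex (w j) ^ (2 * m) =
      (GaussianInt.toComplex (w j) ^ 2 / (q j : ℂ)) ^ m * (q j : ℂ) ^ m := by
    intro j m
    have hq : (q j : ℂ) ≠ 0 := by exact_mod_cast hq0 j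
    rw [pow_mul, ← mul_pow, div_mul_cancel₀ _ hq]
  simp_rw [key]
  rw [Finset.prod_mul_distrib, Finset.prod_mul_distrib, h]
  ring

/-- `e^{i·arg β} = β` for `|β| = 1`. [folklore] -/
theorem exp_arg_mul_I_of_norm_one {β : ℂ} (h : ‖β‖ = 1) : cexp ((β.arg : ℂ) * I) = β := by
  have h1 := Complex.norm_mul_exp_arg_mul_I β
  rw [h] at h1
  simpa using h1

/-- **`ℤ`-INDEPENDENCE OF THE ARGUMENTS `arg(w_j²/q_j)`** — the unimodular algebraic numbers
`β_j = (a_j + i b_j)²/q_j` over distinct primes `q_j = a_j² + b_j² ≡ 1 (4)` are multiplicatively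
independent (no torsion allowed for: `∑ n_j arg β_j = 0` exactly). [folklore] -/
theorem gaussian_linearIndependent_int_arg {N : ℕ} {q : Fin N → ℕ} (hq : ∀ j, (q j).Prime)
    (hqinj : Function.Injective q) (hodd : ∀ j, q j ≠ 2) {w : Fin N → GaussianInt}
    (hw : ∀ j, (w j).re ^ 2 + (w j).im ^ 2 = q j) (ha : ∀ j, (((w j).re : ℤ) : ZMod (q j)) ≠ 0)
    (hb : ∀ j, (((w j).im : ℤ) : ZMod (q j)) ≠ 0)
    (hnorm : ∀ j, ‖GaussianInt.toComplex (w j) ^ 2 / (q j : ℂ)‖ = 1) :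
    LinearIndependent ℤ fun j => (GaussianInt.toComplex (w j) ^ 2 / (q j : ℂ)).arg := by
  classical
  set β : Fin N → ℂ := fun j => GaussianInt.toComplex (w j) ^ 2 / (q j : ℂ) with hβ
  rw [Fintype.linearIndependent_iff]
  intro g hg
  let np : Fin N → ℕ := fun j => (g j).toNat
  let nm : Fin N → ℕ := fun j => (-g j).toNat
  have hgj : ∀ j, (g j : ℝ) = (np j : ℝ) - (nm j : ℝ) := by
    intro j
    have h := Int.toNat_sub_toNat_neg (g j)
    exact_mod_cast h.symm
  have hdisj : ∀ j, np j = 0 ∨ nm j = 0 := by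
    intro j
    rcases le_total (g j) 0 with h | h
    · exact Or.inl (Int.toNat_eq_zero.mpr h)
    · exact Or.inr (Int.toNat_eq_zero.mpr (neg_nonpos.mpr h))
  have hsum : ∑ j, (np j : ℝ) * (β j).arg = ∑ j, (nm j : ℝ) * (β j).arg := by
    rw [← sub_eq_zero, ← Finset.sum_sub_distrib, ← hg]
    refine Finset.sum_congr rfl fun j _ => ?_
    rw [zsmul_eq_mul, hgj, sub_mul]
  have hexp : ∀ m : Fin N → ℕ,
      cexp (((∑ j, (m j : ℝ) * (β j).arg : ℝ) : ℂ) * I) = ∏ j, β j ^ m j := by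
    intro m
    push_cast
    rw [Finset.sum_mul, Complex.exp_sum]
    refine Finset.prod_congr rfl fun j _ => ?_
    rw [mul_assoc, Complex.exp_nat_mul, exp_arg_mul_I_of_norm_one (hnorm j)]
  have hprod : ∏ j, β j ^ np j = ∏ j, β j ^ nm j := by
    rw [← hexp np, ← hexp nm, hsum]
  have hid := gaussian_identity_of_complex (fun j => (hq j).ne_zero) w hprod
  intro j
  have hj := gaussian_identity_trivial hq hqinj hodd hw ha hb hdisj hid j
  have h := hgj j
  rw [hj.1, hj.2, Nat.cast_zero, sub_zero] at h
  exact_mod_cast h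

end GaussianPrimes

/-! ### The family `β_j = (a_j + i b_j)²/q_j` over the primes `q_j ≡ 1 (mod 4)` and its arguments -/

/-- The primes `≡ 1 (mod 4)`. [folklore] -/
def goodPrime : Set ℕ := {p | p.Prime ∧ Nat.ModEq 4 p 1}

/-- There are infinitely many primes `≡ 1 (mod 4)` (cyclotomic argument, Mathlib). [folklore] -/
theorem goodPrime_infinite : goodPrime.Infinite :=
  Nat.frequently_atTop_iff_infinite.mp (Nat.frequently_atTop_modEq_one (by norm_num))

/-- `q_j`: the `j`-th prime `≡ 1 (mod 4)` (`5, 13, 17, 29, …`). [folklore] -/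
def qG (j : ℕ) : ℕ := Nat.nth goodPrime j

/-- `q_j` is a prime `≡ 1 (mod 4)`. [folklore] -/
theorem qG_mem (j : ℕ) : qG j ∈ goodPrime := Nat.nth_mem_of_infinite goodPrime_infinite j

/-- `q_j` is prime. [folklore] -/
theorem qG_prime (j : ℕ) : (qG j).Prime := (qG_mem j).1

/-- `q_j ≠ 2`. [folklore] -/
theorem qG_ne_two (j : ℕ) : qG j ≠ 2 := by
  intro h
  have h1 := (qG_mem j).2
  rw [h] at h1
  exact absurd h1 (by decide)

/-- `j ↦ q_j` is injective. [folklore] -/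
theorem qG_injective : Function.Injective qG := Nat.nth_injective goodPrime_infinite

/-- FERMAT: `q_j = a² + b²`. [folklore] -/
theorem exists_sq_add_sq_qG (j : ℕ) : ∃ a b : ℕ, a ^ 2 + b ^ 2 = qG j := by
  haveI : Fact (qG j).Prime := ⟨qG_prime j⟩
  refine Nat.Prime.sq_add_sq ?_
  have h1 := (qG_mem j).2
  unfold Nat.ModEq at h1
  omega

/-- `a_j`. [folklore] -/
def aG (j : ℕ) : ℕ := Classical.choose (exists_sq_add_sq_qG j)

/-- `b_j`. [folklore] -/
def bG (j : ℕ) : ℕ := Classical.choose (Classical.choose_spec (exists_sq_add_sq_qG j))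

/-- `a_j² + b_j² = q_j`. [folklore] -/
theorem aG_sq_add_bG_sq (j : ℕ) : aG j ^ 2 + bG j ^ 2 = qG j :=
  Classical.choose_spec (Classical.choose_spec (exists_sq_add_sq_qG j))

/-- A prime is not a square. [folklore] -/
theorem sq_ne_of_prime {p b : ℕ} (hp : p.Prime) : b ^ 2 ≠ p := by
  intro h
  have hb : b ∣ p := ⟨b, by rw [← h, sq]⟩
  rcases (Nat.dvd_prime hp).mp hb with h1 | h1
  · rw [h1, one_pow] at h
    exact hp.one_lt.ne h
  · rw [h1] at h
    have h2 : p * p = p * 1 := by rw [mul_one, ← sq, h]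
    exact hp.one_lt.ne' (mul_left_cancel₀ hp.ne_zero h2)

/-- `a_j ≠ 0`. [folklore] -/
theorem aG_ne_zero (j : ℕ) : aG j ≠ 0 := by
  intro h
  have h1 := aG_sq_add_bG_sq j
  rw [h, zero_pow two_ne_zero, zero_add] at h1
  exact sq_ne_of_prime (qG_prime j) h1

/-- `b_j ≠ 0`. [folklore] -/
theorem bG_ne_zero (j : ℕ) : bG j ≠ 0 := by
  intro h
  have h1 := aG_sq_add_bG_sq j
  rw [h, zero_pow two_ne_zero, add_zero] at h1
  exact sq_ne_of_prime (qG_prime j) h1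

/-- `0 < c < q` for `c² ≤ q`, `c ≠ 0`, `q` prime; so `q ∤ c`. [folklore] -/
theorem natCast_zmod_ne_zero {q c : ℕ} (hq : q.Prime) (hc : c ≠ 0) (hcq : c ^ 2 ≤ q) :
    (c : ZMod q) ≠ 0 := by
  intro h
  have hd := (ZMod.natCast_eq_zero_iff c q).mp h
  have hle : q ≤ c := Nat.le_of_dvd (Nat.pos_of_ne_zero hc) hd
  have h1 : c ≤ c ^ 2 := by
    rw [sq]
    exact Nat.le_mul_of_pos_right c (Nat.pos_of_ne_zero hc)
  have hcq' : c = q := le_antisymm (h1.trans hcq) hle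
  subst hcq'
  exact sq_ne_of_prime hq (le_antisymm hcq h1)

/-- `q_j ∤ a_j`. [folklore] -/
theorem aG_zmod_ne_zero (j : ℕ) : (aG j : ZMod (qG j)) ≠ 0 :=
  natCast_zmod_ne_zero (qG_prime j) (aG_ne_zero j) (by rw [← aG_sq_add_bG_sq j]; exact Nat.le_add_right _ _)

/-- `q_j ∤ b_j`. [folklore] -/
theorem bG_zmod_ne_zero (j : ℕ) : (bG j : ZMod (qG j)) ≠ 0 :=
  natCast_zmod_ne_zero (qG_prime j) (bG_ne_zero j) (by rw [← aG_sq_add_bG_sq j]; exact Nat.le_add_left _ _)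

/-- `w_j = a_j + i b_j ∈ ℤ[i]`, a Gaussian prime of norm `q_j`. [folklore] -/
def wG (j : ℕ) : GaussianInt := ⟨aG j, bG j⟩

/-- `(re w_j)² + (im w_j)² = q_j`. [folklore] -/
theorem wG_norm (j : ℕ) : (wG j).re ^ 2 + (wG j).im ^ 2 = qG j := by
  have h := aG_sq_add_bG_sq j
  simp only [wG]
  exact_mod_cast h

/-- `β_j = w_j²/q_j = (a_j + i b_j)/(a_j - i b_j)`: a unimodular algebraic number, not a root of unity.
[folklore] -/
def βG (j : ℕ) : ℂ := GaussianInt.toComplex (wG j) ^ 2 / (qG j : ℂ)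

/-- `w_j = a_j + b_j i` in `ℂ`. [folklore] -/
theorem toComplex_wG (j : ℕ) : GaussianInt.toComplex (wG j) = (aG j : ℂ) + (bG j : ℂ) * I := by
  rw [wG, GaussianInt.toComplex_def']
  norm_cast

/-- `|β_j| = 1`. [folklore] -/
theorem norm_βG (j : ℕ) : ‖βG j‖ = 1 := by
  have hq : (0 : ℝ) < qG j := by exact_mod_cast (qG_prime j).pos
  have h1 : ‖GaussianInt.toComplex (wG j)‖ ^ 2 = qG j := by
    rw [toComplex_wG, ← Complex.normSq_eq_norm_sq]
    have h := Complex.normSq_add_mul_I (aG j) (bG j)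
    have e : ((aG j : ℝ) : ℂ) + ((bG j : ℝ) : ℂ) * I = (aG j : ℂ) + (bG j : ℂ) * I := by norm_cast
    rw [e] at h
    rw [h]
    exact_mod_cast aG_sq_add_bG_sq j
  rw [βG, norm_div, norm_pow, h1]
  rw [show ‖(qG j : ℂ)‖ = (qG j : ℝ) by simp]
  exact div_self hq.ne'

/-- `β_j ∈ ℚ̄`. [folklore] -/
theorem βG_mem_Qb (j : ℕ) : βG j ∈ Qb := by
  unfold βG
  rw [toComplex_wG]
  exact div_mem (pow_mem (add_mem (natCast_mem Qb _) (mul_mem (natCast_mem Qb _) I_mem_Qb)) _)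
    (natCast_mem Qb _)

/-- `β_j` is algebraic. [folklore] -/
theorem βG_isAlgebraic (j : ℕ) : IsAlgebraic ℚ (βG j) := mem_Qb_iff.mp (βG_mem_Qb j)

/-- `t_j = arg β_j`. [folklore] -/
def tG (j : ℕ) : ℝ := (βG j).arg

/-- `e^{i t_j} = β_j`. [folklore] -/
theorem exp_tG_mul_I (j : ℕ) : cexp ((tG j : ℂ) * I) = βG j := exp_arg_mul_I_of_norm_one (norm_βG j)

end Summit.Schanuel.Schanuel.Theorems.RootDecomp1BFinitePinningFloor

end
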